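import Literature.Barriers.FinalStateConjecture.PriceLawTail
import Literature.Geometry.Lorentzian.KerrDomainOfDependence
import Literature.Geometry.Lorentzian.KerrSchildWaveCauchyProblem
import HarnessLib

/-!
# Barrier catalogue `FinalStateConjecture`: the Price-law barrier reduced to Hintz's theorem
# (forcing form) and the Cauchy problem on Kerr–Schild backgrounds
(`Literature/Barriers/FinalStateConjecture/`, D-0021, D-0014; family `gr`; namespace
`Literature.Barriers.FinalStateConjecture`)

`PriceLawTail.lean` vendors the barrier `PriceLawTail` (late-time `τ⁻³` limit of admissible linear
waves on every subextremal Kerr exterior, non-zero for some wave) as a named fact.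
`Literature/Geometry/Lorentzian/KerrPriceLaw.lean` decomposed it into three named facts stated on
the prelude's Kerr–Schild chart — **A** `hintz_priceLaw_forcedWave_kerr` (Hintz, Comm. Math. Phys.
389 (2022), Thm. 4.5 with Thm. 3.4 and Lemma 4.4: Price's law for the forced wave equation, in
exterior consequence form), **B** `kerr_domainOfDependence_ball` (domain of dependence in the
ingoing chart) and **C** `kerr_exists_admissibleKerrWave_of_data` (the Cauchy problem for admissible
waves) — and *proved* both clauses of the barrier from them
(`IsAdmissibleKerrWave.priceLaw_limit`, `exists_admissibleKerrWave_priceLaw_ne_zero`: Hintz's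
reduction of the initial value problem to the forcing problem, Cor. 3.11, and the charge identity
evaluating his constant). Since then **B has been proved**
(`kerr_domainOfDependence_ball_holds`, `KerrDomainOfDependence.lean`, Hawking–Ellis's energy
argument). This file assembles these results and closes the bookkeeping:

* `kerr_exists_admissibleKerrWave_of_data_of_kerrSchild` — **C follows from the single chart-level
  named fact `KerrSchild.waveCauchyProblem`** (`KerrSchildWaveCauchyProblem.lean`: the global Cauchy
  problem with domain of dependence for the divergence-form wave operator of a generalised
  Kerr–Schild metric `η + φ ℓ ⊗ ℓ` on `ℝ⁴` with bounded profile; Bär–Ginoux–Pfäffle 2007,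
  Thm. 3.2.11, on the surgered spacetime, globally hyperbolic by Choquet-Bruhat–Cotsakis 2002,
  Thm. 2.1), through `Kerr.exists_wave_of_data` (metric surgery inside `{r ≤ r₊}`): the solution on
  the whole exterior chart with data `(ψ₀, ψ₁)` vanishes, by the cone clause, on a neighbourhood of
  every leaf point outside `supp ψ₀ ∪ supp ψ₁`, so its data are compactly supported in the open
  leaf (admissibility), and its `∂_{t*}`-derivative on the leaf is `ψ₁`.
* `PriceLawTail.of_facts` — **the barrier from A and C** (B discharged).
* `PriceLawTail.of_hintz` — **the barrier from A and `KerrSchild.waveCauchyProblem`**.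
* `PriceLawTail.limit_of_hintz` — clause (i) alone (every admissible wave has a late-time limit
  `τ³ψ → c`, the same `c` along every `∂_{t*}`-line) needs only A.

After this file the trust base of the barrier is exactly: Hintz's Theorem 4.5 (fact A — the
analytic heart: low-energy resolvent expansion in Vasy's framework, spectral admissibility of
subextremal Kerr via mode stability and the estimates at the horizon and at normally hyperbolic
trapping, §§2–4 of the paper; a theory, kept as a cited named fact) and the textbook Cauchy
problem `KerrSchild.waveCauchyProblem`. When both are discharged,
`theorem PriceLawTail_holds : PriceLawTail := PriceLawTail.of_hintz ‹_› ‹_›` lands here (append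
protocol). No new named fact is introduced.

## References

* P. Hintz, *A sharp version of Price's law for wave decay on asymptotically flat spacetimes*,
  Comm. Math. Phys. 389 (2022) 491–542, arXiv:2004.01664: Thm. 4.5, Thm. 3.4 (EqPWConst),
  Lemma 4.4, Cor. 3.11, Cor. 4.7 (key `Hintz2021`).
* C. Bär, N. Ginoux, F. Pfäffle, *Wave equations on Lorentzian manifolds and quantization*, EMS 2007
  (arXiv:0806.1036), Thm. 3.2.11 (key `BarGinouxPfaffle2007`).
* Y. Choquet-Bruhat, S. Cotsakis, *Global hyperbolicity and completeness*, J. Geom. Phys. 43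
  (2002), Thm. 2.1 (key `ChoquetbruhatCotsakis2002`).
* N. Ginoux, *Linear wave equations*, in LNP 786, Springer 2009, Ch. 3, Thm. 3 and Cor. 5
  (key `Ginoux2009`).
* S. W. Hawking, G. F. R. Ellis, *The large scale structure of space-time*, CUP 1973, §4.3
  (key `HawkingEllis1973CUP`).
-/

noncomputable section

open Set Filter Topology
open scoped Manifold ContDiff

namespace Literature.Barriers.FinalStateConjecture

open Literature.Geometry.Lorentzian

/-! ### Fact C from the Cauchy problem on Kerr–Schild backgrounds -/

/-- The **two-sided gap set is open**: for a compact `K ⊆ E3`, the set of points `z ∈ E4` with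
`|z⁰| < dist (z⃗, k)` for every `k ∈ K` is open (it is `{z | |z⁰| < infDist (z⃗, K)}` for `K ≠ ∅`,
everything for `K = ∅`). [folklore] -/
theorem isOpen_absGapSet {K : Set E3} (hK : IsCompact K) :
    IsOpen {z : E4 | ∀ k ∈ K, |z 0| < dist (E4.spatial z) k} := by
  rcases K.eq_empty_or_nonempty with rfl | hne
  · simp
  · have hcont : Continuous fun z : E4 ↦ Metric.infDist (E4.spatial z) K :=
      (Metric.continuous_infDist_pt K).comp E4.spatial.continuous
    have h0 : Continuous fun z : E4 ↦ |z 0| :=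
      (EuclideanSpace.proj (𝕜 := ℝ) (0 : Fin 4)).continuous.abs
    have heq : {z : E4 | ∀ k ∈ K, |z 0| < dist (E4.spatial z) k} =
        {z : E4 | |z 0| < Metric.infDist (E4.spatial z) K} := by
      ext z
      refine ⟨fun h ↦ ?_, fun h k hk ↦ h.trans_le (Metric.infDist_le_dist_of_mem hk)⟩
      obtain ⟨k₀, hk₀, hk₀eq⟩ := hK.exists_infDist_eq_dist hne (E4.spatial z)
      rw [Set.mem_setOf_eq, hk₀eq]
      exact h k₀ hk₀
    rw [heq]
    exact isOpen_lt h0 hcont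

/-- **Fact C (the Cauchy problem for admissible Kerr waves) follows from the Cauchy problem on
generalised Kerr–Schild backgrounds over `ℝ⁴`.** For subextremal `(M, a)` (so `M > 0`, `r₊ > 0`)
and `ψ₀, ψ₁ ∈ C_c^∞(ℝ³)` supported in the open exterior slice `{r > r₊}`, the solution `ψ` of
`Kerr.exists_wave_of_data` on the whole exterior chart `Kerr.exterior M a = Kerr.region a r₊`
(restriction of the global solution on the surgered background `Kerr.surgeryBackground M a r₊`)
is `C^∞`, solves `□_{g_{M,a}} ψ = 0`, has `ψ(0, y) = ψ₀(y)` and `∂_{t*}ψ(0, y) = ψ₁(y)` on the leaf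
`{t* = 0}` (`timeDeriv ψ = ∂₀ψ̃` is the chart derivative `mfderiv ψ · ∂_{t*}`), and is admissible:
with `S = supp ψ₀ ∪ supp ψ₁` (compact, inside the slice) the compact set `{t* = 0, x⃗ ∈ S}` of the
chart carries the data, because at a leaf point `x` with `x⃗ ∉ S` every point `z` of the open set
`{|z⁰| < dist (z⃗, y) ∀ y ∈ S} ∋ x` lies outside the coordinate cone hull of the data, where `ψ`
vanishes by the cone clause of the fact — so `ψ = 0` near `x` and `dψ(x) = 0`. Bär–Ginoux–Pfäffle
2007, Thm. 3.2.11 with Choquet-Bruhat–Cotsakis 2002, Thm. 2.1 (via `KerrSchild.waveCauchyProblem`);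
this replaces the route through the Cauchy development of the leaf inside Kerr (Ginoux 2009,
Thm. 3/Cor. 5; Bernal–Sánchez 2006) described in the docstring of the fact.
[cite: BarGinouxPfaffle2007, Thm. 3.2.11] -/
theorem kerr_exists_admissibleKerrWave_of_data_of_kerrSchild (h : KerrSchild.waveCauchyProblem) :
    kerr_exists_admissibleKerrWave_of_data := by
  intro _ _ M a hMa ψ₀ ψ₁ hψ₀ hψ₁ hc₀ hc₁ hs₀ hs₁
  -- `Kerr.exterior M a` is the chart `Kerr.region a r₊`
  dsimp only [Kerr.exterior]
  obtain ⟨ψ, hψs, hwave, hdata, hcone⟩ :=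
    Kerr.exists_wave_of_data h hMa.pos.le a hMa.rPlus_pos hψ₀ hψ₁ hc₀ hc₁
  set S : Set E3 := tsupport ψ₀ ∪ tsupport ψ₁ with hS
  have hSc : IsCompact S := hc₀.union hc₁
  have hSs : S ⊆ (Kerr.slice a (Kerr.rPlus M a) : Set E3) := union_subset hs₀ hs₁
  have hcl : Metric.cthickening 0 S = S := by
    rw [Metric.cthickening_zero, hSc.isClosed.closure_eq]
  refine ⟨ψ, ⟨hψs, hwave, ?_⟩, fun x hx0 ↦ ?_⟩
  · -- admissibility: the data are carried by the compact set `{t* = 0, x⃗ ∈ S}` of the chart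
    refine ⟨{x | (x : E4) 0 ∈ Icc (0 : ℝ) 0 ∧ E4.spatial (x : E4) ∈ Metric.cthickening 0 S},
      Kerr.isCompact_strip hSc (hcl.symm ▸ hSs), fun x hx0 hxK ↦ ?_⟩
    have hxS : E4.spatial (x : E4) ∉ S := fun hmem ↦
      hxK ⟨by rw [hx0]; exact ⟨le_rfl, le_rfl⟩, hcl.symm ▸ hmem⟩
    have hgap : ∀ y ∈ S, |(x : E4) 0| < dist (E4.spatial (x : E4)) y := fun y hy ↦ by
      rw [hx0, abs_zero]
      exact dist_pos.mpr fun heq ↦ hxS (heq ▸ hy)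
    have hloc : ψ =ᶠ[𝓝 x] fun _ ↦ 0 := by
      have hopen := (isOpen_absGapSet hSc).preimage
        (continuous_subtype_val (p := (· ∈ Kerr.region a (Kerr.rPlus M a))))
      filter_upwards [hopen.mem_nhds hgap] with z hz
      exact hcone z hz
    exact ⟨hcone x hgap, hloc.mfderiv_eq.trans mfderiv_const⟩
  · -- the data on the leaf
    obtain ⟨h1, h2⟩ := hdata x hx0
    refine ⟨h1, ?_⟩
    rw [← h2, OpensChart.mfderiv_eq x ψ _ (extend_rep ψ)
      ((contDiffAt_extend hψs x).differentiableAt (by simp))]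
    rfl

/-! ### The barrier from the facts -/

/-- **Clause (i) of the barrier from Hintz's theorem alone**: under fact A, for `|a| < M` every
admissible wave `ψ` has a constant `c` with `τ³ ψ(τ, x⃗) → c` along the `∂_{t*}`-line through every
exterior point (`IsAdmissibleKerrWave.priceLaw_limit`, with the domain-of-dependence input
discharged by `kerr_domainOfDependence_ball_holds`). Hintz, arXiv:2004.01664, Thm. 4.5 and
Cor. 3.11. [cite: Hintz2021, Thm. 4.5 and Cor. 3.11] -/
theorem PriceLawTail.limit_of_hintz (hA : hintz_priceLaw_forcedWave_kerr) [Kerr.Facts]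
    [Kerr.SliceFacts] {M a : ℝ} (hMa : Kerr.IsSubextremal M a) {ψ : Kerr.exterior M a → ℝ}
    (hψ : IsAdmissibleKerrWave M a ψ) :
    ∃ c : ℝ, ∀ x : Kerr.exterior M a,
      Tendsto (fun τ : ℝ ↦ τ ^ 3 * ψ (Kerr.atTime a (Kerr.rPlus M a) x τ)) atTop (𝓝 c) :=
  hψ.priceLaw_limit hA kerr_domainOfDependence_ball_holds hMa

/-- **The Price-law barrier from facts A and C** (B being proved): clause (i) is
`IsAdmissibleKerrWave.priceLaw_limit`, clause (ii) is `exists_admissibleKerrWave_priceLaw_ne_zero`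
(an admissible wave with data `(0, ψ₁)`, `ψ₁ ≥ 0` a bump far out, has Hintz constant
`(2M/π) ∫ g^{00} ψ₁ < 0`). Hintz, arXiv:2004.01664, Thm. 4.5, Cor. 3.11, Cor. 4.7.
[cite: Hintz2021, Thm. 4.5, Cor. 3.11 and Cor. 4.7] -/
theorem PriceLawTail.of_facts (hA : hintz_priceLaw_forcedWave_kerr)
    (hC : kerr_exists_admissibleKerrWave_of_data) : PriceLawTail := by
  intro _ _ M a hMa
  refine ⟨fun ψ hψ ↦ PriceLawTail.limit_of_hintz hA hMa hψ, ?_⟩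
  obtain ⟨ψ, hψ, c, hc, hlim⟩ :=
    exists_admissibleKerrWave_priceLaw_ne_zero hA kerr_domainOfDependence_ball_holds hC hMa
  exact ⟨ψ, hψ, c, hc, hlim⟩

/-- **The Price-law barrier from Hintz's theorem and the Cauchy problem on Kerr–Schild
backgrounds**: `PriceLawTail` follows from `hintz_priceLaw_forcedWave_kerr` (Hintz 2022, Thm. 4.5)
and `KerrSchild.waveCauchyProblem` (Bär–Ginoux–Pfäffle 2007, Thm. 3.2.11) — the residual trust base
of the barrier. [cite: Hintz2021, Thm. 4.5; BarGinouxPfaffle2007, Thm. 3.2.11] -/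
theorem PriceLawTail.of_hintz (hA : hintz_priceLaw_forcedWave_kerr)
    (hW : KerrSchild.waveCauchyProblem) : PriceLawTail :=
  PriceLawTail.of_facts hA (kerr_exists_admissibleKerrWave_of_data_of_kerrSchild hW)

end Literature.Barriers.FinalStateConjecture

end
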